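import Literature.Topology.FourManifolds.BoundaryFieldGluing
import HarnessLib

/-!
# Lifts tangent to the boundary which preserve the levels of a boundary-defining function

Topic `Literature/Topology/FourManifolds` (sequel of `BoundaryTangentLift.lean` /
`BoundaryFieldGluing.lean`; fact seat `provefact-Literature.Geometry.Symplectic.Oba2016_s-add47373d4`:
the Ehresmann trivialisation of a Lefschetz fibration near its horizontal boundary must be
compatible with a collar coordinate `σ` of `∂W`, i.e. generated by lifts `Vᵢ` of the coordinate
fields with `dσ(Vᵢ) = 0` near the collar).  Everything is proved; no definitions, no named
facts.

Let `M` be a manifold with boundary (model `𝓡∂ (k + 1)`), `g : M → F` smooth into a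
finite-dimensional space, and `σ : M → ℝ` smooth with `σ = 0` on `∂M`.

* §1 `mlineDeriv_eq_zero_of_tangent_of_forall_boundary` — a vector tangent to `∂M` at a
  boundary point kills `dσ` (the segment in the boundary hyperplane of the chart consists of
  chart values of boundary points, where `σ = 0`; Lee 2012, Prop. 5.41: `T∂M ⊂ TM`);
* §2 `exists_local_lift_level` — at a point `x₀` where `v ↦ (dg v, dσ v)` is onto `F × ℝ` and,
  if `x₀ ∈ ∂M`, `dg` is onto already on the boundary tangent hyperplane, a local smooth field
  `X` with `dg(X) = c`, `dσ(X) = 0` near `x₀`, tangent to `∂M` at the boundary points near `x₀`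
  (local lift through tangent preimages `vⱼ` of a basis and a vector `ν₀ ∈ ker dg` with
  `dσ(ν₀) ≠ 0`; at a boundary point `y` the coefficient of the parallel section through `ν₀`
  must vanish because `dσ(X y) = 0`, `dσ` kills the tangent parallel sections and
  `dσ(parallel ν₀)(y) ≠ 0` near `x₀`);
* §3 `exists_contMDiff_lift_tangent_level` — the global field: tangent to `∂M`, `dg(X) = c` on
  a closed `C`, and `dσ(X) = 0` on a closed `D ⊆ C` along which `(dg, dσ)` is onto (convex
  gluing, `exists_contMDiffSection_forall_mem_convex_of_local`).

## References

* Th. Bröcker, K. Jänich, *Introduction to Differential Topology*, CUP 1982, (8.12) (proof).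
  [BrockerJanichIDT1982]
* J. M. Lee, *Introduction to Smooth Manifolds*, 2nd ed., GTM 218 (2012), Prop. 5.41,
  Thm. 9.34. [LeeSmoothManifolds2013]
-/

open scoped Manifold ContDiff Topology
open Set Function Filter Bundle

noncomputable section

namespace Literature.Topology.FourManifolds

universe u

variable {k : ℕ} {M : Type u} [TopologicalSpace M] [ChartedSpace (EuclideanHalfSpace (k + 1)) M]
  [IsManifold (𝓡∂ (k + 1)) ∞ M]
  {F : Type*} [NormedAddCommGroup F] [NormedSpace ℝ F]

/-! ### §1 Tangent vectors kill the differential of a function vanishing on the boundary -/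

/-- **A vector tangent to `∂M` at a boundary point kills `dσ` for `σ` vanishing on `∂M`**:
read in the chart at `z`, the segment `t ↦ q₀ + t v` lies in the boundary hyperplane, its
points near `q₀` are chart values of boundary points, where `σ = 0`; so the derivative of
`t ↦ σ (φ⁻¹ (q₀ + t v))` at `0`, which is `dσ_z(v)`, vanishes. [cite: LeeSmoothManifolds2013, Prop. 5.41] -/
theorem mlineDeriv_eq_zero_of_tangent_of_forall_boundary {σ : M → ℝ}
    (hσb : ∀ y ∈ (𝓡∂ (k + 1)).boundary M, σ y = 0) {z : M}
    (hσ : MDifferentiableAt (𝓡∂ (k + 1)) 𝓘(ℝ, ℝ) σ z) (hzb : z ∈ (𝓡∂ (k + 1)).boundary M)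
    {v : EuclideanSpace ℝ (Fin (k + 1))} (hv : v 0 = 0) :
    mlineDeriv (𝓡∂ (k + 1)) σ z v = 0 := by
  set I := 𝓡∂ (k + 1) with hI
  set q₀ : EuclideanSpace ℝ (Fin (k + 1)) := extChartAt I z z with hq₀
  set τ : EuclideanSpace ℝ (Fin (k + 1)) → ℝ := writtenInExtChartAt I 𝓘(ℝ, ℝ) z σ with hτ
  set L : EuclideanSpace ℝ (Fin (k + 1)) →L[ℝ] ℝ := mfderiv I 𝓘(ℝ, ℝ) σ z with hL
  have hD : HasFDerivWithinAt τ L (range I) q₀ := by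
    rw [hL, hσ.mfderiv]
    exact hσ.differentiableWithinAt_writtenInExtChartAt.hasFDerivWithinAt
  have hq₀0 : q₀ 0 = 0 := extChartAt_apply_zero_of_mem_boundary (mem_extChartAt_source z) hzb
  have hq₀t : q₀ ∈ (extChartAt I z).target := (extChartAt I z).map_source (mem_extChartAt_source z)
  -- the segment in the boundary hyperplane
  set c : ℝ → EuclideanSpace ℝ (Fin (k + 1)) := fun t => q₀ + t • v with hc
  have hc0 : c 0 = q₀ := by simp [hc]
  have hc_zero : ∀ t, c t 0 = 0 := fun t => by simp [hc, hq₀0, hv]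
  have hc_range : ∀ t, c t ∈ range I := fun t => by
    rw [hI, range_modelWithCornersEuclideanHalfSpace]
    exact (hc_zero t).symm.le
  have hc_deriv : HasDerivAt c v 0 := by
    have h := ((hasDerivAt_id (0 : ℝ)).smul_const v).const_add q₀
    simpa [hc] using h
  have hD' : HasFDerivWithinAt τ L (range I) (c 0) := by rw [hc0]; exact hD
  have h1 : HasDerivWithinAt (τ ∘ c) (L v) univ 0 :=
    hD'.comp_hasDerivWithinAt 0 hc_deriv.hasDerivWithinAt fun t _ => hc_range t
  have h2 : HasDerivAt (τ ∘ c) (L v) 0 := h1.hasDerivAt univ_mem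
  -- but `τ ∘ c` vanishes near `0`
  have hct : Tendsto c (𝓝 0) (𝓝[range I] q₀) := by
    refine tendsto_nhdsWithin_iff.2 ⟨?_, Eventually.of_forall hc_range⟩
    rw [← hc0]; exact hc_deriv.continuousAt
  have hev1 : ∀ᶠ t in 𝓝 0, c t ∈ (extChartAt I z).target :=
    hct (extChartAt_target_mem_nhdsWithin_of_mem hq₀t)
  have hzero : (τ ∘ c) =ᶠ[𝓝 0] fun _ => 0 := by
    filter_upwards [hev1] with t ht1
    have hwb : (extChartAt I z).symm (c t) ∈ I.boundary M :=
      extChartAt_symm_mem_boundary_of_apply_zero ht1 (hc_zero t)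
    simp only [comp_apply, hτ, writtenInExtChartAt, extChartAt_self_apply, modelWithCornersSelf_coe,
      id_eq]
    exact hσb _ hwb
  have h3 : HasDerivAt (τ ∘ c) 0 0 := (hasDerivAt_const (0 : ℝ) (0 : ℝ)).congr_of_eventuallyEq hzero
  have h4 : L v = 0 := h2.unique h3
  exact h4

/-- **A combination of parallel sections through tangent vectors kills `dσ` at boundary
points** (`σ = 0` on `∂M`). [cite: LeeSmoothManifolds2013, Prop. 5.41] -/
theorem mlineDeriv_sum_smul_parallel_eq_zero {σ : M → ℝ} (hσ : ContMDiff (𝓡∂ (k + 1)) 𝓘(ℝ, ℝ) ∞ σ)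
    (hσb : ∀ y ∈ (𝓡∂ (k + 1)).boundary M, σ y = 0) {ι : Type*} [Fintype ι] {x₀ : M}
    (hx₀ : x₀ ∈ (𝓡∂ (k + 1)).boundary M) {v : ι → EuclideanSpace ℝ (Fin (k + 1))}
    (hv : ∀ i, v i 0 = 0) (a : ι → ℝ) {x : M}
    (hx : x ∈ (chartAt (EuclideanHalfSpace (k + 1)) x₀).source) (hxb : x ∈ (𝓡∂ (k + 1)).boundary M) :
    mlineDeriv (𝓡∂ (k + 1)) σ x (∑ i, a i • tangentCoordChange (𝓡∂ (k + 1)) x₀ x x (v i)) = 0 := by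
  have hx' : x ∈ (extChartAt (𝓡∂ (k + 1)) x₀).source := by rwa [extChartAt_source]
  have _ := hx₀
  have hd : MDifferentiableAt (𝓡∂ (k + 1)) 𝓘(ℝ, ℝ) σ x := hσ.mdifferentiableAt (by simp)
  rw [mlineDeriv_def, map_sum]
  refine Finset.sum_eq_zero fun i _ => ?_
  have h : mlineDeriv (𝓡∂ (k + 1)) σ x (tangentCoordChange (𝓡∂ (k + 1)) x₀ x x (v i)) = 0 :=
    mlineDeriv_eq_zero_of_tangent_of_forall_boundary hσb hd hxb
      (tangentCoordChange_apply_zero_of_mem_boundary ⟨hx', mem_extChartAt_source x⟩ hxb (hv i))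
  rw [mlineDeriv_def] at h
  have e1 : mfderiv (𝓡∂ (k + 1)) 𝓘(ℝ, ℝ) σ x (a i • tangentCoordChange (𝓡∂ (k + 1)) x₀ x x (v i)) =
      a i • mfderiv (𝓡∂ (k + 1)) 𝓘(ℝ, ℝ) σ x (tangentCoordChange (𝓡∂ (k + 1)) x₀ x x (v i)) :=
    (mfderiv (𝓡∂ (k + 1)) 𝓘(ℝ, ℝ) σ x).map_smul (a i) _
  refine e1.trans ?_
  rw [h]
  change a i • (0 : ℝ) = 0
  exact smul_zero (a i)

/-! ### §2 Local lifts preserving the levels of `σ` -/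

section Local

variable [FiniteDimensional ℝ F]

omit [IsManifold (𝓡∂ (k + 1)) ∞ M] [FiniteDimensional ℝ F] in
/-- The differential of the pair `(g, σ)` into the normed space `F × ℝ`. [folklore] -/
theorem hasMFDerivAt_pair {g : M → F} {σ : M → ℝ} {x : M}
    {dg : TangentSpace (𝓡∂ (k + 1)) x →L[ℝ] F} (hg : HasMFDerivAt (𝓡∂ (k + 1)) 𝓘(ℝ, F) g x dg)
    {dσ : TangentSpace (𝓡∂ (k + 1)) x →L[ℝ] ℝ} (hσ : HasMFDerivAt (𝓡∂ (k + 1)) 𝓘(ℝ, ℝ) σ x dσ) :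
    HasMFDerivAt (𝓡∂ (k + 1)) 𝓘(ℝ, F × ℝ) (fun y => (g y, σ y)) x (dg.prod dσ) :=
  ⟨hg.1.prodMk hσ.1, hg.2.prodMk hσ.2⟩

omit [IsManifold (𝓡∂ (k + 1)) ∞ M] [FiniteDimensional ℝ F] in
/-- The differential of the pair `(g, σ)` applied to a vector. [folklore] -/
theorem mfderiv_pair_apply {g : M → F} (hg : ContMDiff (𝓡∂ (k + 1)) 𝓘(ℝ, F) ∞ g) {σ : M → ℝ}
    (hσ : ContMDiff (𝓡∂ (k + 1)) 𝓘(ℝ, ℝ) ∞ σ) (x : M) (v : EuclideanSpace ℝ (Fin (k + 1))) :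
    mfderiv (𝓡∂ (k + 1)) 𝓘(ℝ, F × ℝ) (fun y => (g y, σ y)) x v =
      (mfderiv (𝓡∂ (k + 1)) 𝓘(ℝ, F) g x v, mlineDeriv (𝓡∂ (k + 1)) σ x v) := by
  have h := hasMFDerivAt_pair ((hg x).mdifferentiableAt (by simp)).hasMFDerivAt
    ((hσ x).mdifferentiableAt (by simp)).hasMFDerivAt
  rw [h.mfderiv]
  rfl

/-- **Local lifts preserving the levels of `σ`** (the module docstring displays the
construction).  Let `g : M → F`, `σ : M → ℝ` be smooth, `σ = 0` on `∂M`, `x₀ ∈ M` with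
`v ↦ (dg v, dσ v)` onto `F × ℝ` at `x₀` and, if `x₀ ∈ ∂M`, `dg` onto on the boundary tangent
hyperplane at `x₀`.  Then for every `c : F` there are an open `U ∋ x₀` and a vector field `X`
smooth on `U` with `dg(X) = c`, `dσ(X) = 0` on `U`, tangent to `∂M` at the boundary points of
`U`. [cite: BrockerJanichIDT1982, (8.12) (proof)] [cite: LeeSmoothManifolds2013, Prop. 5.41] -/
theorem exists_local_lift_level {g : M → F} (hg : ContMDiff (𝓡∂ (k + 1)) 𝓘(ℝ, F) ∞ g)
    {σ : M → ℝ} (hσ : ContMDiff (𝓡∂ (k + 1)) 𝓘(ℝ, ℝ) ∞ σ)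
    (hσb : ∀ y ∈ (𝓡∂ (k + 1)).boundary M, σ y = 0) {x₀ : M}
    (hjoint : ∀ p : F × ℝ, ∃ v : EuclideanSpace ℝ (Fin (k + 1)),
      mfderiv (𝓡∂ (k + 1)) 𝓘(ℝ, F) g x₀ v = p.1 ∧ mlineDeriv (𝓡∂ (k + 1)) σ x₀ v = p.2)
    (hbdry : x₀ ∈ (𝓡∂ (k + 1)).boundary M → ∀ w : F,
      ∃ v : EuclideanSpace ℝ (Fin (k + 1)), v 0 = 0 ∧ mfderiv (𝓡∂ (k + 1)) 𝓘(ℝ, F) g x₀ v = w)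
    (c : F) :
    ∃ U : Set M, IsOpen U ∧ x₀ ∈ U ∧ ∃ X : Π x : M, TangentSpace (𝓡∂ (k + 1)) x,
      ContMDiffOn (𝓡∂ (k + 1)) (𝓡∂ (k + 1)).tangent ∞
        (fun x => (⟨x, X x⟩ : TangentBundle (𝓡∂ (k + 1)) M)) U ∧
      (∀ x ∈ U, mfderiv (𝓡∂ (k + 1)) 𝓘(ℝ, F) g x (X x) = c) ∧
      (∀ x ∈ U, mlineDeriv (𝓡∂ (k + 1)) σ x (X x) = 0) ∧
      ∀ x ∈ U, x ∈ (𝓡∂ (k + 1)).boundary M → halfSpaceCoord k (X x) = 0 := by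
  classical
  set G : M → F × ℝ := fun y => (g y, σ y) with hG
  have hGs : ContMDiff (𝓡∂ (k + 1)) 𝓘(ℝ, F × ℝ) ∞ G := hg.prodMk_space hσ
  have hGd : ∀ x (v : EuclideanSpace ℝ (Fin (k + 1))), mfderiv (𝓡∂ (k + 1)) 𝓘(ℝ, F × ℝ) G x v =
      (mfderiv (𝓡∂ (k + 1)) 𝓘(ℝ, F) g x v, mlineDeriv (𝓡∂ (k + 1)) σ x v) :=
    fun x v => mfderiv_pair_apply hg hσ x v
  set b := Module.finBasis ℝ F with hb
  set b' := (b.prod (Module.Basis.singleton Unit ℝ)) with hb'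
  -- a kernel vector transverse to the levels of `σ`
  obtain ⟨ν₀, hν₀g, hν₀σ⟩ := hjoint (0, 1)
  by_cases hx₀b : x₀ ∈ (𝓡∂ (k + 1)).boundary M
  · -- ### boundary point: tangent preimages of `b`, and `ν₀`
    choose w hw0 hw using fun i => hbdry hx₀b (b i)
    set v : Fin (Module.finrank ℝ F) ⊕ Unit → EuclideanSpace ℝ (Fin (k + 1)) :=
      fun j => Sum.elim w (fun _ => ν₀) j with hv
    have hv_basis : ∀ j, mfderiv (𝓡∂ (k + 1)) 𝓘(ℝ, F × ℝ) G x₀ (v j) = b' j := by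
      rintro (i | u)
      · rw [hGd]
        refine Prod.ext ?_ ?_
        · simpa [hv, hb'] using hw i
        · rw [hb', Module.Basis.prod_apply_inl_snd]
          exact mlineDeriv_eq_zero_of_tangent_of_forall_boundary hσb
            ((hσ x₀).mdifferentiableAt (by simp)) hx₀b (hw0 i)
      · rw [hGd]
        refine Prod.ext ?_ ?_
        · rw [hb', Module.Basis.prod_apply_inr_fst]; exact hν₀g
        · rw [hb', Module.Basis.prod_apply_inr_snd, Module.Basis.singleton_apply]; exact hν₀σ
    obtain ⟨U, hUo, hx₀U, hUsub, a, ha, hlift⟩ :=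
      exists_local_lift_of_forall_mfderiv_eq hGs b' v hv_basis ((c, 0) : F × ℝ)
    -- the field, its two blocks
    set X : M → EuclideanSpace ℝ (Fin (k + 1)) := fun x =>
      ∑ j, a j x • tangentCoordChange (𝓡∂ (k + 1)) x₀ x x (v j) with hX
    have hXsplit : ∀ x, X x = (∑ i, a (Sum.inl i) x • tangentCoordChange (𝓡∂ (k + 1)) x₀ x x (w i)) +
        a (Sum.inr ()) x • tangentCoordChange (𝓡∂ (k + 1)) x₀ x x ν₀ := by
      intro x
      show (∑ j, a j x • tangentCoordChange (𝓡∂ (k + 1)) x₀ x x (v j)) = _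
      rw [Fintype.sum_sum_type, Fintype.sum_unique (fun u : Unit =>
        a (Sum.inr u) x • tangentCoordChange (𝓡∂ (k + 1)) x₀ x x (v (Sum.inr u)))]
      rfl
    have hXG : ∀ x ∈ U, mfderiv (𝓡∂ (k + 1)) 𝓘(ℝ, F) g x (X x) = c ∧
        mlineDeriv (𝓡∂ (k + 1)) σ x (X x) = 0 := by
      intro x hx
      have h := hlift x hx
      rw [hGd] at h
      exact ⟨congrArg Prod.fst h, congrArg Prod.snd h⟩
    -- where `dσ(parallel ν₀) ≠ 0`
    set ψ : M → ℝ := fun x => mlineDeriv (𝓡∂ (k + 1)) σ x (tangentCoordChange (𝓡∂ (k + 1)) x₀ x x ν₀)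
      with hψ
    have hψs : ContMDiffOn (𝓡∂ (k + 1)) 𝓘(ℝ, ℝ) ∞ ψ (chartAt (EuclideanHalfSpace (k + 1)) x₀).source :=
      contMDiffOn_mlineDeriv_section hσ (contMDiffOn_parallelSection x₀ ν₀)
    have hψ₀ : ψ x₀ = 1 := by
      simp only [hψ, parallelSection_self]; exact hν₀σ
    set U' : Set M := U ∩ ((chartAt (EuclideanHalfSpace (k + 1)) x₀).source ∩ ψ ⁻¹' {t | t ≠ 0}) with hU'
    have hU'o : IsOpen U' :=
      hUo.inter (hψs.continuousOn.isOpen_inter_preimage (chartAt (EuclideanHalfSpace (k + 1)) x₀).open_source isOpen_ne)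
    have hx₀U' : x₀ ∈ U' := ⟨hx₀U, mem_chart_source (EuclideanHalfSpace (k + 1)) x₀, by
      rw [mem_preimage, mem_setOf_eq, hψ₀]; exact one_ne_zero⟩
    refine ⟨U', hU'o, hx₀U', fun x => X x, ?_, fun x hx => (hXG x hx.1).1, fun x hx => (hXG x hx.1).2,
      fun x hx hxb => ?_⟩
    · exact (ContMDiffOn.sum_section fun j _ =>
        (ha j).smul_section ((contMDiffOn_parallelSection x₀ (v j)).mono hUsub)).mono inter_subset_left
    · -- tangency at a boundary point `x ∈ U'`: the coefficient of `parallel ν₀` vanishes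
      have hxs : x ∈ (chartAt (EuclideanHalfSpace (k + 1)) x₀).source := hx.2.1
      have hσX : mlineDeriv (𝓡∂ (k + 1)) σ x (X x) = 0 := (hXG x hx.1).2
      have htan : mlineDeriv (𝓡∂ (k + 1)) σ x
          (∑ i, a (Sum.inl i) x • tangentCoordChange (𝓡∂ (k + 1)) x₀ x x (w i)) = 0 :=
        mlineDeriv_sum_smul_parallel_eq_zero hσ hσb hx₀b hw0 _ hxs hxb
      have hcoef : a (Sum.inr ()) x = 0 := by
        set Lσ : EuclideanSpace ℝ (Fin (k + 1)) →L[ℝ] ℝ := mfderiv (𝓡∂ (k + 1)) 𝓘(ℝ, ℝ) σ x with hLσ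
        have h1 : Lσ (X x) = Lσ (∑ i, a (Sum.inl i) x • tangentCoordChange (𝓡∂ (k + 1)) x₀ x x (w i)) +
            a (Sum.inr ()) x * Lσ (tangentCoordChange (𝓡∂ (k + 1)) x₀ x x ν₀) := by
          rw [hXsplit x, map_add, map_smul, smul_eq_mul]
        have h2 : Lσ (X x) = 0 := hσX
        have h3 : Lσ (∑ i, a (Sum.inl i) x • tangentCoordChange (𝓡∂ (k + 1)) x₀ x x (w i)) = 0 := htan
        have h4 : Lσ (tangentCoordChange (𝓡∂ (k + 1)) x₀ x x ν₀) = ψ x := rfl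
        rw [h2, h3, h4, zero_add] at h1
        have hψx : ψ x ≠ 0 := hx.2.2
        exact (mul_eq_zero.1 h1.symm).resolve_right hψx
      show halfSpaceCoord k (X x) = 0
      rw [hXsplit x, hcoef, zero_smul, add_zero]
      exact halfSpaceCoord_sum_smul_parallelSection_eq_zero hx₀b hw0 _ hxs hxb
  · -- ### interior point: any preimages, restricted to the interior
    have hx₀i : (𝓡∂ (k + 1)).IsInteriorPoint x₀ :=
      ((𝓡∂ (k + 1)).isInteriorPoint_or_isBoundaryPoint x₀).resolve_right hx₀b
    have hjoint' : ∀ j, ∃ v : EuclideanSpace ℝ (Fin (k + 1)),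
        mfderiv (𝓡∂ (k + 1)) 𝓘(ℝ, F × ℝ) G x₀ v = b' j := by
      intro j
      obtain ⟨v, hv1, hv2⟩ := hjoint (b' j)
      exact ⟨v, by rw [hGd]; exact Prod.ext hv1 hv2⟩
    choose v hv using hjoint'
    obtain ⟨U, hUo, hx₀U, hUsub, a, ha, hlift⟩ :=
      exists_local_lift_of_forall_mfderiv_eq hGs b' v hv ((c, 0) : F × ℝ)
    refine ⟨U ∩ (𝓡∂ (k + 1)).interior M,
      hUo.inter (ModelWithCorners.isOpen_interior (I := 𝓡∂ (k + 1)) (M := M) (n := ∞) (by simp)),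
      ⟨hx₀U, hx₀i⟩, fun x => ∑ j, a j x • tangentCoordChange (𝓡∂ (k + 1)) x₀ x x (v j),
      ?_, fun x hx => ?_, fun x hx => ?_, fun x hx hxb => ?_⟩
    · exact (ContMDiffOn.sum_section fun j _ =>
        (ha j).smul_section ((contMDiffOn_parallelSection x₀ (v j)).mono hUsub)).mono inter_subset_left
    · have h := hlift x hx.1
      rw [hGd] at h
      exact congrArg Prod.fst h
    · have h := hlift x hx.1
      rw [hGd] at h
      exact congrArg Prod.snd h
    · exact absurd hx.2 (((𝓡∂ (k + 1)).isBoundaryPoint_iff_not_isInteriorPoint x).1 hxb)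

end Local

/-! ### §3 The global field -/

section Global

variable [FiniteDimensional ℝ F] [T2Space M] [SigmaCompactSpace M]

omit [IsManifold (𝓡∂ (k + 1)) ∞ M] [FiniteDimensional ℝ F] [T2Space M] [SigmaCompactSpace M] in
/-- The constraint set: tangent at boundary points, `dg = c` on `C`, `dσ = 0` on `D`; convex.
[folklore] -/
theorem convex_levelLiftConstraint (g : M → F) (σ : M → ℝ) (C D : Set M) (c : F) (x : M) :
    Convex ℝ {v : TangentSpace (𝓡∂ (k + 1)) x |
      (x ∈ (𝓡∂ (k + 1)).boundary M → halfSpaceCoord k v = 0) ∧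
      (x ∈ C → mfderiv (𝓡∂ (k + 1)) 𝓘(ℝ, F) g x v = c) ∧
      (x ∈ D → mlineDeriv (𝓡∂ (k + 1)) σ x v = 0)} := by
  intro u hu w hw p q _ _ hpq
  refine ⟨fun hxb => ?_, fun hxC => ?_, fun hxD => ?_⟩
  · set L : TangentSpace (𝓡∂ (k + 1)) x →L[ℝ] ℝ := halfSpaceCoord k with hL
    have h1 : L u = 0 := hu.1 hxb
    have h2 : L w = 0 := hw.1 hxb
    change L (p • u + q • w) = 0
    rw [map_add, map_smul, map_smul, h1, h2, smul_zero, smul_zero, add_zero]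
  · have h1 := hu.2.1 hxC
    have h2 := hw.2.1 hxC
    rw [map_add, map_smul, map_smul, h1, h2, ← add_smul, hpq, one_smul]
  · have h1 := hu.2.2 hxD
    have h2 := hw.2.2 hxD
    rw [mlineDeriv_add, mlineDeriv_smul, mlineDeriv_smul, h1, h2, mul_zero, mul_zero, add_zero]

/-- **Lifting a vector tangentially to the boundary and along the levels of `σ`.**  Let
`g : M → F`, `σ : M → ℝ` be smooth on the `σ`-compact Hausdorff manifold with boundary `M`,
`σ = 0` on `∂M`, `C ⊆ M` closed with `dg` onto at its interior points and onto on the boundary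
tangent hyperplane at its boundary points, and `D ⊆ C` closed with `(dg, dσ)` onto `F × ℝ` at
its points.  Then for every `c : F` some smooth vector field `X` on `M`, tangent to `∂M` at
every boundary point, satisfies `dg(X) = c` on `C` and `dσ(X) = 0` on `D`.
[cite: BrockerJanichIDT1982, (8.12) (proof)] [cite: LeeSmoothManifolds2013, Thm. 9.34] -/
theorem exists_contMDiff_lift_tangent_level {g : M → F} (hg : ContMDiff (𝓡∂ (k + 1)) 𝓘(ℝ, F) ∞ g)
    {σ : M → ℝ} (hσ : ContMDiff (𝓡∂ (k + 1)) 𝓘(ℝ, ℝ) ∞ σ)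
    (hσb : ∀ y ∈ (𝓡∂ (k + 1)).boundary M, σ y = 0)
    {C : Set M} (hC : IsClosed C) {D : Set M} (hD : IsClosed D) (hDC : D ⊆ C)
    (hint : ∀ x ∈ C, (𝓡∂ (k + 1)).IsInteriorPoint x →
      Surjective (mfderiv (𝓡∂ (k + 1)) 𝓘(ℝ, F) g x))
    (hbdry : ∀ x ∈ C, x ∈ (𝓡∂ (k + 1)).boundary M → ∀ w : F,
      ∃ v : EuclideanSpace ℝ (Fin (k + 1)), v 0 = 0 ∧ mfderiv (𝓡∂ (k + 1)) 𝓘(ℝ, F) g x v = w)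
    (hjoint : ∀ x ∈ D, ∀ p : F × ℝ, ∃ v : EuclideanSpace ℝ (Fin (k + 1)),
      mfderiv (𝓡∂ (k + 1)) 𝓘(ℝ, F) g x v = p.1 ∧ mlineDeriv (𝓡∂ (k + 1)) σ x v = p.2)
    (c : F) :
    ∃ X : Π x : M, TangentSpace (𝓡∂ (k + 1)) x,
      ContMDiff (𝓡∂ (k + 1)) (𝓡∂ (k + 1)).tangent ∞
        (fun x => (⟨x, X x⟩ : TangentBundle (𝓡∂ (k + 1)) M)) ∧
      (∀ z ∈ (𝓡∂ (k + 1)).boundary M, halfSpaceCoord k (X z) = 0) ∧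
      (∀ x ∈ C, mfderiv (𝓡∂ (k + 1)) 𝓘(ℝ, F) g x (X x) = c) ∧
      ∀ x ∈ D, mlineDeriv (𝓡∂ (k + 1)) σ x (X x) = 0 := by
  classical
  set b := Module.finBasis ℝ F with hb
  set t : ∀ x : M, Set (TangentSpace (𝓡∂ (k + 1)) x) := fun x =>
    {v | (x ∈ (𝓡∂ (k + 1)).boundary M → halfSpaceCoord k v = 0) ∧
      (x ∈ C → mfderiv (𝓡∂ (k + 1)) 𝓘(ℝ, F) g x v = c) ∧
      (x ∈ D → mlineDeriv (𝓡∂ (k + 1)) σ x v = 0)} with ht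
  have hloc : ∀ x₀ : M, ∃ U ∈ 𝓝 x₀, ∃ X : Π x : M, TangentSpace (𝓡∂ (k + 1)) x,
      ContMDiffOn (𝓡∂ (k + 1)) ((𝓡∂ (k + 1)).prod 𝓘(ℝ, EuclideanSpace ℝ (Fin (k + 1)))) ∞
        (fun x => TotalSpace.mk' (EuclideanSpace ℝ (Fin (k + 1))) x (X x)) U ∧
      ∀ y ∈ U, X y ∈ t y := by
    intro x₀
    by_cases hx₀D : x₀ ∈ D
    · -- on `D`: the level lift
      obtain ⟨U, hUo, hx₀U, X, hXs, hXg, hXσ, hXt⟩ := exists_local_lift_level hg hσ hσb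
        (hjoint x₀ hx₀D) (fun hx₀b => hbdry x₀ (hDC hx₀D) hx₀b) c
      exact ⟨U, hUo.mem_nhds hx₀U, X, hXs, fun y hy =>
        ⟨fun hyb => hXt y hy hyb, fun _ => hXg y hy, fun _ => hXσ y hy⟩⟩
    by_cases hx₀C : x₀ ∈ C
    · by_cases hx₀b : x₀ ∈ (𝓡∂ (k + 1)).boundary M
      · choose v hv0 hv using fun i => hbdry x₀ hx₀C hx₀b (b i)
        obtain ⟨U, hUo, hx₀U, hUsub, a, ha, hlift⟩ :=
          exists_local_lift_of_forall_mfderiv_eq hg b v hv c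
        refine ⟨U ∩ Dᶜ, (hUo.inter hD.isOpen_compl).mem_nhds ⟨hx₀U, hx₀D⟩,
          fun x => ∑ i, a i x • tangentCoordChange (𝓡∂ (k + 1)) x₀ x x (v i),
          ?_, fun y hy => ⟨fun hyb => ?_, fun _ => hlift y hy.1, fun hyD => absurd hyD hy.2⟩⟩
        · exact (ContMDiffOn.sum_section fun i _ =>
            (ha i).smul_section ((contMDiffOn_parallelSection x₀ (v i)).mono hUsub)).mono
            inter_subset_left
        · exact halfSpaceCoord_sum_smul_parallelSection_eq_zero hx₀b hv0 _ (hUsub hy.1) hyb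
      · have hx₀i : (𝓡∂ (k + 1)).IsInteriorPoint x₀ := by
          by_contra h
          exact hx₀b (((𝓡∂ (k + 1)).isBoundaryPoint_iff_not_isInteriorPoint x₀).2 h)
        have hsurj : ∀ w : F, ∃ v : EuclideanSpace ℝ (Fin (k + 1)),
            mfderiv (𝓡∂ (k + 1)) 𝓘(ℝ, F) g x₀ v = w := fun w => hint x₀ hx₀C hx₀i w
        choose v hv using fun i => hsurj (b i)
        obtain ⟨U, hUo, hx₀U, hUsub, a, ha, hlift⟩ :=
          exists_local_lift_of_forall_mfderiv_eq hg b v hv c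
        refine ⟨(U ∩ Dᶜ) ∩ (𝓡∂ (k + 1)).interior M,
          ((hUo.inter hD.isOpen_compl).inter (ModelWithCorners.isOpen_interior (I := 𝓡∂ (k + 1))
            (M := M) (n := ∞) (by simp))).mem_nhds ⟨⟨hx₀U, hx₀D⟩, hx₀i⟩,
          fun x => ∑ i, a i x • tangentCoordChange (𝓡∂ (k + 1)) x₀ x x (v i),
          ?_, fun y hy => ⟨fun hyb => ?_, fun _ => hlift y hy.1.1, fun hyD => absurd hyD hy.1.2⟩⟩
        · exact (ContMDiffOn.sum_section fun i _ =>
            (ha i).smul_section ((contMDiffOn_parallelSection x₀ (v i)).mono hUsub)).mono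
            (inter_subset_left.trans inter_subset_left)
        · exact absurd hy.2 (((𝓡∂ (k + 1)).isBoundaryPoint_iff_not_isInteriorPoint y).1 hyb)
    · refine ⟨Cᶜ, hC.isOpen_compl.mem_nhds hx₀C, fun _ => 0,
        (contMDiff_zeroSection ℝ (TangentSpace (𝓡∂ (k + 1)) : M → Type _)).contMDiffOn, fun y hy =>
        ⟨fun _ => map_zero _, fun hyC => absurd hyC hy, fun hyD => absurd (hDC hyD) hy⟩⟩
  obtain ⟨s, hs⟩ := exists_contMDiffSection_forall_mem_convex_of_local (n := (⊤ : ℕ∞)) (𝓡∂ (k + 1))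
    (fun x => TangentSpace (𝓡∂ (k + 1)) x) t (fun x => convex_levelLiftConstraint g σ C D c x) hloc
  exact ⟨s, s.contMDiff, fun z hz => (hs z).1 hz, fun x hx => (hs x).2.1 hx, fun x hx => (hs x).2.2 hx⟩

end Global

end Literature.Topology.FourManifolds

end
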